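import Literature.Barriers.ABC.BakerMethodBoundsStewartYu1991LineProofs
import HarnessLib

/-!
# Cell abc-stewartyu, the κ-DOOR, II: the real-number book-keeping of two slots

`Summits/ABC/StewartYu/KappaDoorAlgebra.lean` — cell `abc-stewartyu` (HOME
`run/shared/lean/pub/abc-stewartyu/`, seat p3; HOME/plan/KAPPA-DOOR-RECIPE.md; theorems only).

Pure inequalities between real numbers, isolated from the arithmetic so that the assembly
(`KappaDoorMain.lean`) is book-keeping only:

* `rpow_eq_mul_rpow_sub_one` — `N^{κ'} = N · N^{κ'−1}` (`N > 0`); `rpow_le_mul_of_le_two` —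
  `P^σ ≤ P · P` for `P ≥ 1`, `0 ≤ σ ≤ 2`;
* **`two_slot_bound`** — two `p`-adic slots `uᵢ ≤ K L^{nᵢ} Nᵢ^{κ'} Pᵢ^σ Ωᵢ Y` with the Chebyshev
  absorptions `N₁ P₂ Ω₁ ≤ 600^{n₁+1} R₁ Λ³`, `N₂ P₁ Ω₂ ≤ 600^{n₂+1} R₂ Λ³`, `Pᵢ ≤ ρᵢ`,
  `R₁ R₂ ρ₁ ρ₂ ≤ G²`, `N₁ N₂ ≤ W²`, `n₁ + n₂ ≤ 2r` give
  `u₁ u₂ ≤ K² (600L)^{2r} 600² G² (W²)^{κ'−1} Λ⁶ Y²`;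
* **`slot_arch_bound`** — a `p`-adic slot and the archimedean slot bounding the same `u`:
  `u² ≤ 16 K (600 M₀)^{2r} 600² G² W^{κ'−1} Λ⁶ Y Y'`;
* small reshaping lemmas (`rpow_mul_natCast_eq`, `one_le_pow_self`, `prod_log_le_prod_log_max_four`,
  `slot_reshape`) used by `KappaDoorEven.lean` / `KappaDoorOdd.lean`.

Everything is [folklore].
-/

noncomputable section

open Finset Real

namespace Summit.ABC.StewartYu

namespace KappaDoor

/-- `N^{κ'} = N · N^{κ'−1}` for `N > 0`. [folklore] -/
theorem rpow_eq_mul_rpow_sub_one {N κ' : ℝ} (hN : 0 < N) : N ^ κ' = N * N ^ (κ' - 1) := by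
  conv_lhs => rw [show κ' = 1 + (κ' - 1) by ring, Real.rpow_add hN, Real.rpow_one]

/-- `P^σ ≤ P · P` for `P ≥ 1` and `0 ≤ σ ≤ 2`. [folklore] -/
theorem rpow_le_mul_self_of_le_two {P σ : ℝ} (hP : 1 ≤ P) (hσ : σ ≤ 2) : P ^ σ ≤ P * P := by
  calc P ^ σ ≤ P ^ (2 : ℝ) := Real.rpow_le_rpow_of_exponent_le hP hσ
    _ = P * P := by rw [show (2 : ℝ) = ((2 : ℕ) : ℝ) by norm_num, Real.rpow_natCast, sq]

/-- `(600 L)^{n} ≤ (600 L)^{m}` bookkeeping: `L^{n} · 600^{n+1} ≤ 600 · (600L)^{m}` for `n ≤ m`, `L ≥ 1`.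
[folklore] -/
theorem pow_mul_pow_succ_le {L : ℝ} (hL : 1 ≤ L) {n m : ℕ} (hnm : n ≤ m) :
    L ^ n * 600 ^ (n + 1) ≤ 600 * (600 * L) ^ m := by
  have h1 : (1 : ℝ) ≤ 600 * L := by linarith
  calc L ^ n * 600 ^ (n + 1) = 600 * (600 * L) ^ n := by rw [pow_succ, mul_pow]; ring
    _ ≤ 600 * (600 * L) ^ m := by
        exact mul_le_mul_of_nonneg_left (pow_le_pow_right₀ h1 hnm) (by norm_num)

/-- **Two `p`-adic slots.** [folklore] -/
theorem two_slot_bound {K L κ' σ u₁ u₂ N₁ N₂ P₁ P₂ Ω₁ Ω₂ Y R₁ R₂ ρ₁ ρ₂ Λ G W : ℝ} {n₁ n₂ r : ℕ}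
    (hK : 0 ≤ K) (hL : 1 ≤ L) (hκ' : 1 ≤ κ') (hσ : σ ≤ 2)
    (hu₁ : 0 ≤ u₁) (hu₂ : 0 ≤ u₂) (hN₁ : 1 ≤ N₁) (hN₂ : 1 ≤ N₂) (hP₁ : 1 ≤ P₁) (hP₂ : 1 ≤ P₂)
    (hΩ₁ : 0 ≤ Ω₁) (hΩ₂ : 0 ≤ Ω₂) (hY : 0 ≤ Y) (hR₁ : 0 ≤ R₁) (hR₂ : 0 ≤ R₂) (hΛ : 0 ≤ Λ)
    (h₁ : u₁ ≤ K * L ^ n₁ * N₁ ^ κ' * P₁ ^ σ * Ω₁ * Y)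
    (h₂ : u₂ ≤ K * L ^ n₂ * N₂ ^ κ' * P₂ ^ σ * Ω₂ * Y)
    (habs₁ : N₁ * P₂ * Ω₁ ≤ 600 ^ (n₁ + 1) * R₁ * Λ ^ 3)
    (habs₂ : N₂ * P₁ * Ω₂ ≤ 600 ^ (n₂ + 1) * R₂ * Λ ^ 3)
    (hρ₁ : P₁ ≤ ρ₁) (hρ₂ : P₂ ≤ ρ₂) (hG : R₁ * R₂ * (ρ₁ * ρ₂) ≤ G ^ 2) (hNW : N₁ * N₂ ≤ W ^ 2)
    (hn : n₁ + n₂ ≤ 2 * r) :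
    u₁ * u₂ ≤ K ^ 2 * (600 * L) ^ (2 * r) * 600 ^ 2 * G ^ 2 * (W ^ 2) ^ (κ' - 1) * Λ ^ 6 * Y ^ 2 := by
  have hN₁0 : 0 < N₁ := by linarith
  have hN₂0 : 0 < N₂ := by linarith
  have hP₁0 : 0 ≤ P₁ := by linarith
  have hP₂0 : 0 ≤ P₂ := by linarith
  have hκ0 : 0 ≤ κ' - 1 := by linarith
  -- split `N^{κ'}` and bound `P^σ`
  have e₁ : N₁ ^ κ' = N₁ * N₁ ^ (κ' - 1) := rpow_eq_mul_rpow_sub_one hN₁0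
  have e₂ : N₂ ^ κ' = N₂ * N₂ ^ (κ' - 1) := rpow_eq_mul_rpow_sub_one hN₂0
  have hp₁ : P₁ ^ σ ≤ P₁ * ρ₁ := (rpow_le_mul_self_of_le_two hP₁ hσ).trans
    (mul_le_mul_of_nonneg_left hρ₁ hP₁0)
  have hp₂ : P₂ ^ σ ≤ P₂ * ρ₂ := (rpow_le_mul_self_of_le_two hP₂ hσ).trans
    (mul_le_mul_of_nonneg_left hρ₂ hP₂0)
  have hNκ₁ : 0 ≤ N₁ ^ (κ' - 1) := Real.rpow_nonneg hN₁0.le _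
  have hNκ₂ : 0 ≤ N₂ ^ (κ' - 1) := Real.rpow_nonneg hN₂0.le _
  -- the two slots with `P^σ` replaced
  have h₁' : u₁ ≤ K * L ^ n₁ * (N₁ * N₁ ^ (κ' - 1)) * (P₁ * ρ₁) * Ω₁ * Y := by
    refine h₁.trans ?_
    rw [e₁]
    have h0 : 0 ≤ K * L ^ n₁ * (N₁ * N₁ ^ (κ' - 1)) := by positivity
    exact mul_le_mul_of_nonneg_right (mul_le_mul_of_nonneg_right
      (mul_le_mul_of_nonneg_left hp₁ h0) hΩ₁) hY
  have h₂' : u₂ ≤ K * L ^ n₂ * (N₂ * N₂ ^ (κ' - 1)) * (P₂ * ρ₂) * Ω₂ * Y := by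
    refine h₂.trans ?_
    rw [e₂]
    have h0 : 0 ≤ K * L ^ n₂ * (N₂ * N₂ ^ (κ' - 1)) := by positivity
    exact mul_le_mul_of_nonneg_right (mul_le_mul_of_nonneg_right
      (mul_le_mul_of_nonneg_left hp₂ h0) hΩ₂) hY
  have hρ₁0 : 0 ≤ ρ₁ := hP₁0.trans hρ₁
  have hρ₂0 : 0 ≤ ρ₂ := hP₂0.trans hρ₂
  have hB0 : 0 ≤ K * L ^ n₂ * (N₂ * N₂ ^ (κ' - 1)) * (P₂ * ρ₂) * Ω₂ * Y := by positivity
  have hprod := mul_le_mul h₁' h₂' hu₂ (hu₁.trans h₁')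
  -- regroup
  have e : K * L ^ n₁ * (N₁ * N₁ ^ (κ' - 1)) * (P₁ * ρ₁) * Ω₁ * Y *
      (K * L ^ n₂ * (N₂ * N₂ ^ (κ' - 1)) * (P₂ * ρ₂) * Ω₂ * Y) =
      K ^ 2 * (L ^ n₁ * L ^ n₂) * ((N₁ * P₂ * Ω₁) * (N₂ * P₁ * Ω₂)) * (ρ₁ * ρ₂) *
        (N₁ ^ (κ' - 1) * N₂ ^ (κ' - 1)) * Y ^ 2 := by ring
  rw [e] at hprod
  -- the absorptions
  have hA : (N₁ * P₂ * Ω₁) * (N₂ * P₁ * Ω₂) ≤ (600 ^ (n₁ + 1) * R₁ * Λ ^ 3) * (600 ^ (n₂ + 1) * R₂ * Λ ^ 3) :=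
    mul_le_mul habs₁ habs₂ (by positivity) (by positivity)
  -- the surplus
  have hS : N₁ ^ (κ' - 1) * N₂ ^ (κ' - 1) ≤ (W ^ 2) ^ (κ' - 1) := by
    rw [← Real.mul_rpow hN₁0.le hN₂0.le]
    exact Real.rpow_le_rpow (by positivity) hNW hκ0
  -- the powers of `L` and `600`
  have h600L : (1 : ℝ) ≤ 600 * L := by linarith
  have hL0 : 0 ≤ L := by linarith
  have hLpow : L ^ n₁ * L ^ n₂ * (600 ^ (n₁ + 1) * 600 ^ (n₂ + 1)) ≤ (600 * L) ^ (2 * r) * 600 ^ 2 := by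
    have e' : L ^ n₁ * L ^ n₂ * (600 ^ (n₁ + 1) * 600 ^ (n₂ + 1)) = (600 * L) ^ (n₁ + n₂) * 600 ^ 2 := by
      rw [mul_pow, pow_add, pow_add, pow_add L]; ring
    rw [e']
    exact mul_le_mul_of_nonneg_right (pow_le_pow_right₀ h600L hn) (by norm_num)
  calc u₁ * u₂ ≤ K ^ 2 * (L ^ n₁ * L ^ n₂) * ((N₁ * P₂ * Ω₁) * (N₂ * P₁ * Ω₂)) * (ρ₁ * ρ₂) *
        (N₁ ^ (κ' - 1) * N₂ ^ (κ' - 1)) * Y ^ 2 := hprod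
    _ ≤ K ^ 2 * (L ^ n₁ * L ^ n₂) * ((600 ^ (n₁ + 1) * R₁ * Λ ^ 3) * (600 ^ (n₂ + 1) * R₂ * Λ ^ 3)) *
        (ρ₁ * ρ₂) * (W ^ 2) ^ (κ' - 1) * Y ^ 2 := by
        have h0 : 0 ≤ K ^ 2 * (L ^ n₁ * L ^ n₂) := by positivity
        refine mul_le_mul_of_nonneg_right ?_ (by positivity)
        exact mul_le_mul (mul_le_mul_of_nonneg_right (mul_le_mul_of_nonneg_left hA h0) (by positivity))
          hS (by positivity) (by positivity)
    _ = K ^ 2 * (L ^ n₁ * L ^ n₂ * (600 ^ (n₁ + 1) * 600 ^ (n₂ + 1))) * (R₁ * R₂ * (ρ₁ * ρ₂)) *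
        (W ^ 2) ^ (κ' - 1) * Λ ^ 6 * Y ^ 2 := by ring
    _ ≤ K ^ 2 * ((600 * L) ^ (2 * r) * 600 ^ 2) * G ^ 2 * (W ^ 2) ^ (κ' - 1) * Λ ^ 6 * Y ^ 2 := by
        have hWκ : 0 ≤ (W ^ 2) ^ (κ' - 1) := Real.rpow_nonneg (by positivity) _
        refine mul_le_mul_of_nonneg_right (mul_le_mul_of_nonneg_right
          (mul_le_mul_of_nonneg_right ?_ hWκ) (by positivity)) (by positivity)
        exact mul_le_mul (mul_le_mul_of_nonneg_left hLpow (by positivity)) hG (by positivity) (by positivity)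
    _ = K ^ 2 * (600 * L) ^ (2 * r) * 600 ^ 2 * G ^ 2 * (W ^ 2) ^ (κ' - 1) * Λ ^ 6 * Y ^ 2 := by ring

/-- **A `p`-adic slot and the archimedean slot on the same member.** [folklore] -/
theorem slot_arch_bound {K L C M₀ κ' σ u N N' P Ω Ω' Y Y' R R' ρ Λ G W : ℝ} {n n' r : ℕ}
    (hK : 0 ≤ K) (hL : 1 ≤ L) (hC : 1 ≤ C) (hLM : L ≤ M₀) (hCM : C ≤ M₀) (hκ' : 1 ≤ κ') (hσ : σ ≤ 2)
    (hu : 0 ≤ u) (hN : 1 ≤ N) (hN' : 0 ≤ N') (hP : 1 ≤ P) (hΩ : 0 ≤ Ω) (hΩ' : 0 ≤ Ω') (hY : 0 ≤ Y)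
    (hY' : 0 ≤ Y') (hR : 0 ≤ R) (hR' : 0 ≤ R') (hΛ : 0 ≤ Λ) (hW1 : 1 ≤ W)
    (h₁ : u ≤ K * L ^ n * N ^ κ' * P ^ σ * Ω * Y)
    (h₂ : u ≤ 16 * (C ^ n' * N' * Ω' * Y'))
    (habs : N * Ω ≤ 600 ^ (n + 1) * R * Λ ^ 3)
    (habs' : N' * P * Ω' ≤ 600 ^ (n' + 1) * R' * Λ ^ 3)
    (hρ : P ≤ ρ) (hG : R * R' * ρ ≤ G ^ 2) (hNW : N ≤ W) (hn : n + n' ≤ 2 * r) :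
    u ^ 2 ≤ 16 * K * (600 * M₀) ^ (2 * r) * 600 ^ 2 * G ^ 2 * (W ^ 2) ^ (κ' - 1) * Λ ^ 6 * (Y * Y') := by
  have hN0 : 0 < N := by linarith
  have hP0 : 0 ≤ P := by linarith
  have hκ0 : 0 ≤ κ' - 1 := by linarith
  have hM1 : 1 ≤ M₀ := hL.trans hLM
  have e₁ : N ^ κ' = N * N ^ (κ' - 1) := rpow_eq_mul_rpow_sub_one hN0
  have hp : P ^ σ ≤ P * ρ := (rpow_le_mul_self_of_le_two hP hσ).trans (mul_le_mul_of_nonneg_left hρ hP0)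
  have hNκ : 0 ≤ N ^ (κ' - 1) := Real.rpow_nonneg hN0.le _
  have h₁' : u ≤ K * L ^ n * (N * N ^ (κ' - 1)) * (P * ρ) * Ω * Y := by
    refine h₁.trans ?_
    rw [e₁]
    have h0 : 0 ≤ K * L ^ n * (N * N ^ (κ' - 1)) := by positivity
    exact mul_le_mul_of_nonneg_right (mul_le_mul_of_nonneg_right (mul_le_mul_of_nonneg_left hp h0) hΩ) hY
  have hρ0 : 0 ≤ ρ := hP0.trans hρ
  have hprod := mul_le_mul h₁' h₂ hu (hu.trans h₁')
  have e : K * L ^ n * (N * N ^ (κ' - 1)) * (P * ρ) * Ω * Y * (16 * (C ^ n' * N' * Ω' * Y')) =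
      16 * K * (L ^ n * C ^ n') * ((N * Ω) * (N' * P * Ω')) * ρ * N ^ (κ' - 1) * (Y * Y') := by ring
  rw [sq]
  have hA : (N * Ω) * (N' * P * Ω') ≤ (600 ^ (n + 1) * R * Λ ^ 3) * (600 ^ (n' + 1) * R' * Λ ^ 3) :=
    mul_le_mul habs habs' (by positivity) (by positivity)
  have hS : N ^ (κ' - 1) ≤ (W ^ 2) ^ (κ' - 1) := by
    refine Real.rpow_le_rpow hN0.le (hNW.trans ?_) hκ0
    calc W = W * 1 := (mul_one W).symm
      _ ≤ W * W := mul_le_mul_of_nonneg_left hW1 (by linarith)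
      _ = W ^ 2 := (sq W).symm
  have h600M : (1 : ℝ) ≤ 600 * M₀ := by linarith
  have hM0 : 0 ≤ M₀ := by linarith
  have hLC : L ^ n * C ^ n' * (600 ^ (n + 1) * 600 ^ (n' + 1)) ≤ (600 * M₀) ^ (2 * r) * 600 ^ 2 := by
    have h1 : L ^ n ≤ M₀ ^ n := pow_le_pow_left₀ (by linarith) hLM n
    have h2 : C ^ n' ≤ M₀ ^ n' := pow_le_pow_left₀ (by linarith) hCM n'
    calc L ^ n * C ^ n' * (600 ^ (n + 1) * 600 ^ (n' + 1))
        ≤ M₀ ^ n * M₀ ^ n' * (600 ^ (n + 1) * 600 ^ (n' + 1)) :=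
          mul_le_mul_of_nonneg_right (mul_le_mul h1 h2 (by positivity) (by positivity)) (by positivity)
      _ = (600 * M₀) ^ (n + n') * 600 ^ 2 := by rw [mul_pow, pow_add, pow_add, pow_add M₀]; ring
      _ ≤ (600 * M₀) ^ (2 * r) * 600 ^ 2 :=
          mul_le_mul_of_nonneg_right (pow_le_pow_right₀ h600M hn) (by norm_num)
  calc u * u ≤ K * L ^ n * (N * N ^ (κ' - 1)) * (P * ρ) * Ω * Y * (16 * (C ^ n' * N' * Ω' * Y')) := hprod
    _ = 16 * K * (L ^ n * C ^ n') * ((N * Ω) * (N' * P * Ω')) * ρ * N ^ (κ' - 1) * (Y * Y') := e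
    _ ≤ 16 * K * (L ^ n * C ^ n') * ((600 ^ (n + 1) * R * Λ ^ 3) * (600 ^ (n' + 1) * R' * Λ ^ 3)) * ρ *
          (W ^ 2) ^ (κ' - 1) * (Y * Y') := by
        have h0 : 0 ≤ 16 * K * (L ^ n * C ^ n') := by positivity
        refine mul_le_mul_of_nonneg_right ?_ (by positivity)
        exact mul_le_mul (mul_le_mul_of_nonneg_right (mul_le_mul_of_nonneg_left hA h0) hρ0) hS hNκ
          (by positivity)
    _ = 16 * K * (L ^ n * C ^ n' * (600 ^ (n + 1) * 600 ^ (n' + 1))) * (R * R' * ρ) *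
          (W ^ 2) ^ (κ' - 1) * Λ ^ 6 * (Y * Y') := by ring
    _ ≤ 16 * K * ((600 * M₀) ^ (2 * r) * 600 ^ 2) * G ^ 2 * (W ^ 2) ^ (κ' - 1) * Λ ^ 6 * (Y * Y') := by
        have hWκ : 0 ≤ (W ^ 2) ^ (κ' - 1) := Real.rpow_nonneg (by positivity) _
        refine mul_le_mul_of_nonneg_right (mul_le_mul_of_nonneg_right
          (mul_le_mul_of_nonneg_right ?_ hWκ) (by positivity)) (by positivity)
        exact mul_le_mul (mul_le_mul_of_nonneg_left hLC (by positivity)) hG (by positivity) (by positivity)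
    _ = 16 * K * (600 * M₀) ^ (2 * r) * 600 ^ 2 * G ^ 2 * (W ^ 2) ^ (κ' - 1) * Λ ^ 6 * (Y * Y') := by ring

/-! ### Small reshaping lemmas -/

/-- `n^{κ' n} = (nⁿ)^{κ'}` (real powers, `n ∈ ℕ`). [folklore] -/
theorem rpow_mul_natCast_eq (n : ℕ) (κ' : ℝ) : (n : ℝ) ^ (κ' * n) = ((n : ℝ) ^ n) ^ κ' := by
  rw [mul_comm, Real.rpow_mul (Nat.cast_nonneg n), Real.rpow_natCast]

/-- `1 ≤ nⁿ` (with `0⁰ = 1`). [folklore] -/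
theorem one_le_pow_self (n : ℕ) : (1 : ℝ) ≤ (n : ℝ) ^ n := by
  rcases Nat.eq_zero_or_pos n with rfl | hn
  · simp
  · exact one_le_pow₀ (by exact_mod_cast hn)

/-- `∏_{q ∈ S} log q ≤ ∏_{q ∈ S} log max(4, q)` for a set of primes. [folklore] -/
theorem prod_log_le_prod_log_max_four {S : Finset ℕ} (hS : ∀ q ∈ S, q.Prime) :
    ∏ q ∈ S, Real.log (q : ℝ) ≤ ∏ q ∈ S, Real.log ((max 4 q : ℕ) : ℝ) := by
  refine Finset.prod_le_prod (fun q hq => Real.log_nonneg (by exact_mod_cast (hS q hq).one_lt.le))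
    fun q hq => ?_
  exact Real.log_le_log (by exact_mod_cast (hS q hq).pos) (by exact_mod_cast le_max_right 4 q)

/-- `0 ≤ ∏_{q ∈ S} log q` for a set of primes. [folklore] -/
theorem prod_log_nonneg {S : Finset ℕ} (hS : ∀ q ∈ S, q.Prime) : 0 ≤ ∏ q ∈ S, Real.log (q : ℝ) :=
  Finset.prod_nonneg fun q hq => Real.log_nonneg (by exact_mod_cast (hS q hq).one_lt.le)

/-- Reshaping a slot: `n^{κ'n} ↦ (nⁿ)^{κ'}`, `∏ log q ↦ Ω₄ ≥ ∏ log q`, `Y ↦ Y' ≥ Y`, with a front factor `m ≥ 1`.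
[folklore] -/
theorem slot_reshape {K L κ' Pσ Ω Ω₄ Y Y' x m : ℝ} {n : ℕ} (hK : 0 ≤ K) (hL : 0 ≤ L) (hPσ : 0 ≤ Pσ)
    (hΩ : 0 ≤ Ω) (hΩ₄ : Ω ≤ Ω₄) (hY : 0 ≤ Y) (hYY' : Y ≤ Y') (hm : 1 ≤ m)
    (h : x ≤ m * (K * L ^ n * (n : ℝ) ^ (κ' * n) * Pσ * Ω * Y)) :
    x ≤ (m * K) * L ^ n * ((n : ℝ) ^ n) ^ κ' * Pσ * Ω₄ * Y' := by
  rw [rpow_mul_natCast_eq] at h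
  have hN : 0 ≤ ((n : ℝ) ^ n) ^ κ' := Real.rpow_nonneg (pow_nonneg (Nat.cast_nonneg _) _) _
  refine h.trans ?_
  have h0 : 0 ≤ m * K * L ^ n * ((n : ℝ) ^ n) ^ κ' * Pσ := by
    have : 0 ≤ m := by linarith
    positivity
  calc m * (K * L ^ n * ((n : ℝ) ^ n) ^ κ' * Pσ * Ω * Y)
      = (m * K * L ^ n * ((n : ℝ) ^ n) ^ κ' * Pσ) * (Ω * Y) := by ring
    _ ≤ (m * K * L ^ n * ((n : ℝ) ^ n) ^ κ' * Pσ) * (Ω₄ * Y') :=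
        mul_le_mul_of_nonneg_left (mul_le_mul hΩ₄ hYY' hY (hΩ.trans hΩ₄)) h0
    _ = (m * K) * L ^ n * ((n : ℝ) ^ n) ^ κ' * Pσ * Ω₄ * Y' := by ring

end KappaDoor

end Summit.ABC.StewartYu

end
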